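import Mathlib
import Summits.ValiantsHypothesis.ValiantsHypothesis.Theorems.ProofCarryingSymmetryRestorationQPPCUnfoldEqLeaves

/-!
# Route ProofCarryingSymmetry — crux `RestorationQP`, line `registered`: Hrubeš–Tzameret Remark 1.3 for the tree's `P_c`

Part B of "circuits with the same unfolding are `P_c`-interderivable in polynomial size" (part A:
…PCUnfoldEqLeaves — unfoldings of prefixes, leaf and junk lines):

* `Real.pairStep` — prefixes `pre N₁ i`, `pre N₂ j` with the same unfolding are interderivable
  given the lines of all earlier non-leaf pairs (C1/C2 unsharing on both sides, the children's
  lines, congruence), cost `≤ 500 M`;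
* `real_stageU` — all pairs bottom-up as ONE proof DAG;
* **`hasPCProofOfSize_of_unfold_eq`** — HT Remark 1.3 over a commutative ring: `C₁• = C₂•`
  ⇒ a `P_c` proof of `C₁ = C₂` of size `≤ 504·(3(|C₁|+|C₂|)+7)·(|C₁|+1)·(|C₂|+1)`;
* `hasPCProofOfSize_rename_of_unfold_eq` — presentation independence of the conclusion of stub T′
  (`stub_invarianceProvableQP'`): invariance proofs transfer between circuits with the same
  unfolding at polynomial cost.

Caveat (part 3 of the necessity programme): without A6–A10 the statement fails for the tree's
presentations (dead weight is rigid in the AC fragment), so axiom-metered budgets — unlike sizes —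
are presentation-sensitive; this is why the line's stability pair is typed over unfoldings.
Everything proved, no named facts.
-/

-- single-problem summit: `Summit.ValiantsHypothesis.ValiantsHypothesis.…` is the namespace by design (D-0017)
set_option linter.dupNamespace false

namespace Summit.ValiantsHypothesis.ValiantsHypothesis.Theorems

namespace PCR

open Literature.Computability.AlgebraicComplexity PICircuit

universe u v

variable {𝔽 : Type u} {X : Type v}

/-! ### The pair step -/

section Pairs

variable [CommRing 𝔽]

/-- A formula is a leaf. [folklore] -/
def IsLeafF (φ : PIFormula 𝔽 X) : Prop := (∃ x, φ = .var x) ∨ (∃ c, φ = .const c)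

/-- **Child lines.** For child prefixes `pre (N₁.take i) a`, `pre (N₂.take j) a'` with the same
unfolding: leaves are joined through the one-node circuit; non-leaves sit at earlier positions and
their line is looked up among the realized lines (`hIH`). Cost `≤ 210 M`. [folklore] -/
theorem Real.childLine {L : List (PICircuit 𝔽 X × PICircuit 𝔽 X)} {n : ℕ} (h : Real (pcSystem 𝔽 X) L n)
    (N₁ N₂ : List (Node 𝔽 X)) (i j a a' : ℕ) (hj : j ≤ N₂.length)
    (heq : (pre (N₁.take i) a).unfold = (pre (N₂.take j) a').unfold)
    (hIH : ∀ a a', a < i → a' ≤ N₂.length → (pre N₁ a).unfold = (pre N₂ a').unfold →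
      ¬ IsLeafF (pre N₁ a).unfold → (pre N₁ a, pre N₂ a') ∈ L)
    {M : ℕ} (hM₁ : 3 * N₁.length + 7 ≤ M) (hM₂ : 3 * N₂.length + 7 ≤ M) :
    Real (pcSystem 𝔽 X) ((pre (N₁.take i) a, pre (N₂.take j) a') :: L) (n + 210 * M) := by
  by_cases hleaf : IsLeafF (pre (N₁.take i) a).unfold
  · have hM₁' : 3 * (N₁.take i).length + 7 ≤ M := by simp; omega
    have hM₂' : 3 * (N₂.take j).length + 7 ≤ M := by simp; omega
    exact h.leafPair (N₁.take i) (N₂.take j) a a' rfl heq.symm hleaf hM₁' hM₂'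
  · -- non-leaf: both child indices are earlier positions, the line is already realized
    have hnc : ∀ c : 𝔽, (pre (N₁.take i) a).unfold ≠ .const c := fun c hc => hleaf (Or.inr ⟨c, hc⟩)
    have hnc' : ∀ c : 𝔽, (pre (N₂.take j) a').unfold ≠ .const c := fun c hc => hleaf (Or.inr ⟨c, heq.trans hc⟩)
    have ha : a < i := lt_of_unfold_pre_take N₁ hnc
    have ha' : a' < j := lt_of_unfold_pre_take N₂ hnc'
    rw [pre_take_of_lt N₁ ha] at heq hleaf ⊢
    rw [pre_take_of_lt N₂ ha'] at heq ⊢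
    have hm := hIH a a' ha (by omega) heq hleaf
    exact h.mono (List.cons_subset.2 ⟨hm, List.Subset.refl _⟩) (by omega)

/-- **The pair step.** Prefixes `pre N₁ i`, `pre N₂ j` (`j ≤ |N₂|`) with the same unfolding are
interderivable, given the lines of all earlier non-leaf pairs; cost `≤ 500 M`. [folklore] -/
theorem Real.pairStep {L : List (PICircuit 𝔽 X × PICircuit 𝔽 X)} {n : ℕ} (h : Real (pcSystem 𝔽 X) L n)
    (N₁ N₂ : List (Node 𝔽 X)) (i j : ℕ) (hj : j ≤ N₂.length) (heq : (pre N₁ i).unfold = (pre N₂ j).unfold)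
    (hIH : ∀ a a', a < i → a' ≤ N₂.length → (pre N₁ a).unfold = (pre N₂ a').unfold →
      ¬ IsLeafF (pre N₁ a).unfold → (pre N₁ a, pre N₂ a') ∈ L)
    {M : ℕ} (hM₁ : 3 * N₁.length + 7 ≤ M) (hM₂ : 3 * N₂.length + 7 ≤ M) :
    Real (pcSystem 𝔽 X) ((pre N₁ i, pre N₂ j) :: L) (n + 500 * M) := by
  -- sizes
  have sz : ∀ k, (pcSystem 𝔽 X).size (pre N₁ k) ≤ M ∧ (pcSystem 𝔽 X).size (pre N₂ k) ≤ M := fun k => by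
    have := size_pre_le N₁ k; have := size_pre_le N₂ k; simp only [pcSystem]; omega
  have szt : ∀ k a b, (pcSystem 𝔽 X).size (PICircuit.add (pre (N₁.take k) a) (pre (N₁.take k) b)) ≤ M ∧
      (pcSystem 𝔽 X).size (PICircuit.mul (pre (N₁.take k) a) (pre (N₁.take k) b)) ≤ M ∧
      (pcSystem 𝔽 X).size (PICircuit.add (pre (N₂.take k) a) (pre (N₂.take k) b)) ≤ M ∧
      (pcSystem 𝔽 X).size (PICircuit.mul (pre (N₂.take k) a) (pre (N₂.take k) b)) ≤ M := fun k a b => by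
    have h1 := size_pre_le (N₁.take k) a; have h2 := size_pre_le (N₁.take k) b
    have h3 := size_pre_le (N₂.take k) a; have h4 := size_pre_le (N₂.take k) b
    simp only [List.length_take] at h1 h2 h3 h4
    simp only [pcSystem, PICircuit.size_add, PICircuit.size_mul]; omega
  cases hφ : (pre N₁ i).unfold with
  | var x => exact (h.leafPair N₁ N₂ i j hφ (heq ▸ hφ) (Or.inl ⟨x, rfl⟩) hM₁ hM₂).mono (List.Subset.refl _) (by omega)
  | const c => exact (h.leafPair N₁ N₂ i j hφ (heq ▸ hφ) (Or.inr ⟨c, rfl⟩) hM₁ hM₂).mono (List.Subset.refl _) (by omega)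
  | add φ ψ =>
    obtain ⟨a, b, hi, hn₁, hua, hub⟩ := node_of_unfold_add N₁ hφ
    obtain ⟨a', b', hj', hn₂, hua', hub'⟩ := node_of_unfold_add N₂ (heq ▸ hφ)
    have r1 := h.childLine N₁ N₂ i j a a' hj (hua.trans hua'.symm) hIH hM₁ hM₂
    have r2 := r1.childLine N₁ N₂ i j b b' hj (hub.trans hub'.symm)
      (fun a a' ha ha' he hl => List.mem_cons_of_mem _ (hIH a a' ha ha' he hl)) hM₁ hM₂
    have r3 := r2.axmB (.inr (isExtra_pre_add_take hn₁)) (sz i).1 (szt i a b).1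
    have r4 := r3.axmB (.inr (isExtra_pre_add_take hn₂)) (sz j).2 (szt j a' b').2.2.1
    have r5 := r4.congrAddB (List.mem_cons_of_mem _ (List.mem_cons_of_mem _ (List.mem_cons_of_mem _ List.mem_cons_self)))
      (List.mem_cons_of_mem _ (List.mem_cons_of_mem _ List.mem_cons_self)) (szt i a b).1 (szt j a' b').2.2.1
    have r6 := r5.symmB (List.mem_cons_of_mem _ List.mem_cons_self) (sz j).2 (szt j a' b').2.2.1
    have r7 := r6.trans₃ (List.mem_cons_of_mem _ (List.mem_cons_of_mem _ (List.mem_cons_of_mem _ List.mem_cons_self)))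
      (List.mem_cons_of_mem _ List.mem_cons_self) List.mem_cons_self (sz i).1 (szt j a' b').2.2.1 (sz j).2
    refine r7.mono (List.cons_subset_cons _ fun e he => ?_) (by omega)
    iterate 6 apply List.mem_cons_of_mem
    exact he
  | mul φ ψ =>
    obtain ⟨a, b, hi, hn₁, hua, hub⟩ := node_of_unfold_mul N₁ hφ
    obtain ⟨a', b', hj', hn₂, hua', hub'⟩ := node_of_unfold_mul N₂ (heq ▸ hφ)
    have r1 := h.childLine N₁ N₂ i j a a' hj (hua.trans hua'.symm) hIH hM₁ hM₂
    have r2 := r1.childLine N₁ N₂ i j b b' hj (hub.trans hub'.symm)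
      (fun a a' ha ha' he hl => List.mem_cons_of_mem _ (hIH a a' ha ha' he hl)) hM₁ hM₂
    have r3 := r2.axmB (.inr (isExtra_pre_mul_take hn₁)) (sz i).1 (szt i a b).2.1
    have r4 := r3.axmB (.inr (isExtra_pre_mul_take hn₂)) (sz j).2 (szt j a' b').2.2.2
    have r5 := r4.congrMulB (List.mem_cons_of_mem _ (List.mem_cons_of_mem _ (List.mem_cons_of_mem _ List.mem_cons_self)))
      (List.mem_cons_of_mem _ (List.mem_cons_of_mem _ List.mem_cons_self)) (szt i a b).2.1 (szt j a' b').2.2.2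
    have r6 := r5.symmB (List.mem_cons_of_mem _ List.mem_cons_self) (sz j).2 (szt j a' b').2.2.2
    have r7 := r6.trans₃ (List.mem_cons_of_mem _ (List.mem_cons_of_mem _ (List.mem_cons_of_mem _ List.mem_cons_self)))
      (List.mem_cons_of_mem _ List.mem_cons_self) List.mem_cons_self (sz i).1 (szt j a' b').2.2.2 (sz j).2
    refine r7.mono (List.cons_subset_cons _ fun e he => ?_) (by omega)
    iterate 6 apply List.mem_cons_of_mem
    exact he

/-! ### All pairs, bottom-up -/

open scoped Classical in
/-- Row `i`: the lines `(pre N₁ i, pre N₂ a')` for `a' < j` with equal unfoldings. [folklore] -/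
noncomputable def rowU (N₁ N₂ : List (Node 𝔽 X)) (i : ℕ) : ℕ → List (PICircuit 𝔽 X × PICircuit 𝔽 X)
  | 0 => []
  | j + 1 => (if (pre N₁ i).unfold = (pre N₂ j).unfold then [(pre N₁ i, pre N₂ j)] else []) ++ rowU N₁ N₂ i j

/-- Stage `i`: all rows below `i`, each up to `|N₂| + 1`. [folklore] -/
noncomputable def stageU (N₁ N₂ : List (Node 𝔽 X)) : ℕ → List (PICircuit 𝔽 X × PICircuit 𝔽 X)
  | 0 => []
  | i + 1 => rowU N₁ N₂ i (N₂.length + 1) ++ stageU N₁ N₂ i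

/-- Membership in a row. [folklore] -/
theorem mem_rowU (N₁ N₂ : List (Node 𝔽 X)) (i : ℕ) : ∀ (j a' : ℕ), a' < j →
    (pre N₁ i).unfold = (pre N₂ a').unfold → (pre N₁ i, pre N₂ a') ∈ rowU N₁ N₂ i j
  | 0, a', h, _ => absurd h (Nat.not_lt_zero _)
  | j + 1, a', h, he => by
    rw [rowU]
    rcases Nat.lt_succ_iff_lt_or_eq.1 h with h | rfl
    · exact List.mem_append_right _ (mem_rowU N₁ N₂ i j a' h he)
    · rw [if_pos he]; exact List.mem_append_left _ List.mem_cons_self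

/-- Membership in a stage. [folklore] -/
theorem mem_stageU (N₁ N₂ : List (Node 𝔽 X)) : ∀ (i a a' : ℕ), a < i → a' ≤ N₂.length →
    (pre N₁ a).unfold = (pre N₂ a').unfold → (pre N₁ a, pre N₂ a') ∈ stageU N₁ N₂ i
  | 0, a, a', h, _, _ => absurd h (Nat.not_lt_zero _)
  | i + 1, a, a', h, ha', he => by
    rw [stageU]
    rcases Nat.lt_succ_iff_lt_or_eq.1 h with h | rfl
    · exact List.mem_append_right _ (mem_stageU N₁ N₂ i a a' h ha' he)
    · exact List.mem_append_left _ (mem_rowU N₁ N₂ a _ a' (by omega) he)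

/-- Realizing a row on top of a stage. [folklore] -/
theorem real_rowU (N₁ N₂ : List (Node 𝔽 X)) (i : ℕ) {M : ℕ} (hM₁ : 3 * N₁.length + 7 ≤ M)
    (hM₂ : 3 * N₂.length + 7 ≤ M) {c : ℕ} (h : Real (pcSystem 𝔽 X) (stageU N₁ N₂ i) c) :
    ∀ j, j ≤ N₂.length + 1 → Real (pcSystem 𝔽 X) (rowU N₁ N₂ i j ++ stageU N₁ N₂ i) (c + 500 * M * j) := by
  intro j
  induction j with
  | zero => intro _; simpa [rowU] using h
  | succ j ih =>
    intro hj
    have r := ih (by omega)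
    by_cases he : (pre N₁ i).unfold = (pre N₂ j).unfold
    · have step := r.pairStep N₁ N₂ i j (by omega) he (fun a a' ha ha' heq _ =>
        List.mem_append_right _ (mem_stageU N₁ N₂ i a a' ha ha' heq)) hM₁ hM₂
      refine step.mono (fun e hm => ?_) (by nlinarith)
      rw [rowU, if_pos he] at hm
      simpa using hm
    · refine r.mono (fun e hm => ?_) (by nlinarith)
      rw [rowU, if_neg he] at hm
      simpa using hm

/-- Realizing all stages. [folklore] -/
theorem real_stageU (N₁ N₂ : List (Node 𝔽 X)) {M : ℕ} (hM₁ : 3 * N₁.length + 7 ≤ M)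
    (hM₂ : 3 * N₂.length + 7 ≤ M) :
    ∀ i, Real (pcSystem 𝔽 X) (stageU N₁ N₂ i) (500 * M * (N₂.length + 1) * i) := by
  intro i
  induction i with
  | zero => simpa [stageU] using (real_nil (S := pcSystem 𝔽 X))
  | succ i ih =>
    have r := real_rowU N₁ N₂ i hM₁ hM₂ ih (N₂.length + 1) le_rfl
    rw [stageU]
    exact r.mono (List.Subset.refl _) (by ring_nf; omega)

/-- **Hrubeš–Tzameret Remark 1.3 for the tree's `P_c` (over a commutative ring)**: circuits with the
same unfolding are interderivable by ONE proof DAG of size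
`≤ 504·(3(|C₁|+|C₂|)+7)·(|C₁|+1)·(|C₂|+1)`. [folklore] -/
theorem hasPCProofOfSize_of_unfold_eq (C₁ C₂ : PICircuit 𝔽 X) (hu : C₁.unfold = C₂.unfold) :
    HasPCProofOfSize C₁ C₂ (504 * (3 * (C₁.size + C₂.size) + 7) * (C₁.size + 1) * (C₂.size + 1)) := by
  set N₁ := C₁.nodes with hN₁
  set N₂ := C₂.nodes with hN₂
  set M := 3 * (C₁.size + C₂.size) + 7 with hM
  have hl₁ : N₁.length = C₁.size := C₁.length_nodes
  have hl₂ : N₂.length = C₂.size := C₂.length_nodes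
  have hM₁ : 3 * N₁.length + 7 ≤ M := by rw [hl₁, hM]; omega
  have hM₂ : 3 * N₂.length + 7 ≤ M := by rw [hl₂, hM]; omega
  have h1 : pre N₁ C₁.body.length = C₁ := pre_nodes C₁
  have h2 : pre N₂ C₂.body.length = C₂ := pre_nodes C₂
  have r := real_stageU N₁ N₂ hM₁ hM₂ N₁.length
  have hmem : (pre N₁ C₁.body.length, pre N₂ C₂.body.length) ∈ stageU N₁ N₂ N₁.length :=
    mem_stageU N₁ N₂ _ _ _ (by rw [hl₁]; exact Nat.lt_succ_self _)
      (by rw [hl₂]; exact Nat.le_succ _) (by rw [h1, h2, hu])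
  have hp := r.provable hmem
  rw [h1, h2] at hp
  refine PISystem.Provable.mono hp ?_ fun _ => le_rfl
  have : (pcSystem 𝔽 X).size C₁ + (pcSystem 𝔽 X).size C₂ ≤ M := by simp only [pcSystem]; omega
  rw [hl₁, hl₂]
  have key : 500 * M * (C₂.size + 1) * C₁.size + 2 * M ≤ 504 * M * (C₁.size + 1) * (C₂.size + 1) := by
    have e : 504 * M * (C₁.size + 1) * (C₂.size + 1) =
        500 * M * (C₂.size + 1) * C₁.size + (500 * M * (C₂.size + 1) + 4 * M * ((C₁.size + 1) * (C₂.size + 1))) := by ring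
    have h1 : 1 ≤ (C₁.size + 1) * (C₂.size + 1) := Nat.one_le_iff_ne_zero.2 (by positivity)
    have h4 : 4 * M ≤ 4 * M * ((C₁.size + 1) * (C₂.size + 1)) := Nat.le_mul_of_pos_right _ h1
    omega
  exact_mod_cast (show 500 * M * (C₂.size + 1) * C₁.size + 2 * ((pcSystem 𝔽 X).size C₁ + (pcSystem 𝔽 X).size C₂) ≤
    504 * M * (C₁.size + 1) * (C₂.size + 1) by omega)

/-- **Presentation independence of invariance proofs**: if `C₁ ∘ ρ = C₁` has a `P_c` proof of size
`t` and `C₂` unfolds like `C₁`, then `C₂ ∘ ρ = C₂` has one of size `t` plus a polynomial in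
`|C₁| + |C₂|` (chain `C₂ ∘ ρ = C₁ ∘ ρ = C₁ = C₂`). [folklore] -/
theorem hasPCProofOfSize_rename_of_unfold_eq (ρ : X → X) {C₁ C₂ : PICircuit 𝔽 X} (hu : C₁.unfold = C₂.unfold)
    {t : ℕ} (h : HasPCProofOfSize (C₁.rename ρ) C₁ t) :
    HasPCProofOfSize (C₂.rename ρ) C₂ (t + 1010 * (3 * (C₁.size + C₂.size) + 7) * (C₁.size + 1) * (C₂.size + 1)) := by
  have hu' : (C₂.rename ρ).unfold = (C₁.rename ρ).unfold := by rw [unfold_rename, unfold_rename, hu]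
  have h1 := hasPCProofOfSize_of_unfold_eq (C₂.rename ρ) (C₁.rename ρ) hu'
  have h3 := hasPCProofOfSize_of_unfold_eq C₁ C₂ hu
  rw [size_rename, size_rename] at h1
  have h12 := PISystem.Provable.trans h1 h
  have h123 := PISystem.Provable.trans h12 h3
  refine PISystem.Provable.mono h123 ?_ (fun _ => le_top)
  simp only [pcSystem, size_rename]
  set M := 3 * (C₁.size + C₂.size) + 7 with hM
  have hM' : 3 * (C₂.size + C₁.size) + 7 = M := by rw [hM]; ring
  rw [hM']
  have e1 : 504 * M * (C₂.size + 1) * (C₁.size + 1) = 504 * M * (C₁.size + 1) * (C₂.size + 1) := by ring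
  rw [e1]
  have hc : C₂.size + C₁.size + (C₂.size + C₂.size) ≤ 2 * M * (C₁.size + 1) * (C₂.size + 1) := by
    have h1 : 1 ≤ (C₁.size + 1) * (C₂.size + 1) := Nat.one_le_iff_ne_zero.2 (by positivity)
    have h4 : 2 * M ≤ 2 * M * ((C₁.size + 1) * (C₂.size + 1)) := Nat.le_mul_of_pos_right _ h1
    have e : 2 * M * (C₁.size + 1) * (C₂.size + 1) = 2 * M * ((C₁.size + 1) * (C₂.size + 1)) := by ring
    omega
  push_cast
  have : (504 * M * (C₁.size + 1) * (C₂.size + 1) : ℕ∞) + t + ((C₂.size : ℕ∞) + C₁.size) +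
      (504 * M * (C₁.size + 1) * (C₂.size + 1)) + ((C₂.size : ℕ∞) + C₂.size) ≤
      t + 1010 * M * (C₁.size + 1) * (C₂.size + 1) := by
    have key : 504 * M * (C₁.size + 1) * (C₂.size + 1) + t + (C₂.size + C₁.size) +
        504 * M * (C₁.size + 1) * (C₂.size + 1) + (C₂.size + C₂.size) ≤ t + 1010 * M * (C₁.size + 1) * (C₂.size + 1) := by
      nlinarith [hc]
    exact_mod_cast key
  exact this

end Pairs

end PCR

open Literature.Computability.AlgebraicComplexity in
/-- **Hrubeš–Tzameret Remark 1.3 for the tree's `P_c(ℂ)`** (registered helper toward stub T′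
`stub_invarianceProvableQP'`, crux `RestorationQP`; presentation independence of its conclusion):
two Hrubeš–Tzameret circuits over the matrix variables with the same unfolding are interderivable in
`P_c(ℂ)` in size `≤ 504·(3(|C₁|+|C₂|)+7)·(|C₁|+1)·(|C₂|+1)`. [folklore] -/
theorem invarianceProvableQP_aux_unfoldEq : ∀ (n : ℕ) (C₁ C₂ : PICircuit ℂ (Fin n × Fin n)), C₁.unfold = C₂.unfold → HasPCProofOfSize C₁ C₂ (504 * (3 * (C₁.size + C₂.size) + 7) * (C₁.size + 1) * (C₂.size + 1)) := by
  intro n C₁ C₂ h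
  exact PCR.hasPCProofOfSize_of_unfold_eq C₁ C₂ h

end Summit.ValiantsHypothesis.ValiantsHypothesis.Theorems
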